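import Literature.NumberTheory.EllipticCurves.LatticeHomOfCurveKernelProofs
import Literature.NumberTheory.EllipticCurves.EichlerShimuraConstructionLatticeProofs
import Literature.NumberTheory.EllipticCurves.IsogenyCompProofs
import Literature.NumberTheory.EllipticCurves.ComplexPeriodProofs
import HarnessLib

/-!
# A `K`-isogeny at a complex embedding: `z ↦ σ(α)z` with `[Λ' : σ(α)Λ] = deg ψ` and `α ∈ K`

Topic `NumberTheory/EllipticCurves`; a proofs-only file (theorems only: no definitions, no named
facts), in `namespace WeierstrassCurve.Isogeny` (deliberate dot-notation extensions of the
tree's `WeierstrassCurve.Isogeny`, as its sibling `Isogeny…Proofs` files).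

For an isogeny `ψ : E → E'` of elliptic curves **defined over a number field `K`** (the tree's
`WeierstrassCurve.Isogeny`: an additive, generically rational, `Γ_K`-equivariant map on
`K̄`-points with finite kernel; `ψ.degree = #ker ψ`) and a complex embedding `σ : K → ℂ`, the
base change `ψ^σ : E^σ(ℂ) → E'^σ(ℂ)` is, on `ℂ/Λ → ℂ/Λ'` (period lattices of the invariant
differentials), the map `z ↦ α_σ z` with `α_σ Λ ⊆ Λ'` (Silverman, *AEC*, Thm. VI.4.1(b)); its
kernel `α_σ⁻¹Λ'/Λ` has `[Λ' : α_σΛ] = deg ψ` elements; and `α_σ = σ(α)` for the *multiplier*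
`α ∈ Kˣ` of `ψ`, `ψ^*ω' = αω` (*AEC* III.5: the pull-back of the invariant differential by a
`K`-isogeny is a `K`-multiple of the invariant differential). Consequently
`|σ(α)|² covol(Λ) = deg ψ · covol(Λ')` at every `σ` — the archimedean input
`‖ψ^*β‖²_σ = deg ψ · ‖β‖²_σ` of Faltings' isogeny lemma (Faltings 1983, §3, Lemma 5) for
elliptic curves, here for the tree's `WeierstrassCurve.complexPeriod = 2 covol`.

The tree proved the case `K = ℚ` without the degree
(`EichlerShimuraConstructionLatticeProofs.neronLattice_commensurable_of_isogeny_of_baseChange_eq_curve`: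
`aΛ ⊆ Λ'` for a non-zero integer `a`); this file runs the same argument over `K`, keeping track
of the kernel through `PeriodPair.exists_mul_of_curve_hom_card_ker`
(`LatticeHomOfCurveKernelProofs`):

* `exists_mul_of_map_eq_curve` — one embedding `σ` with a chosen extension `ι : K̄ → ℂ`, short
  models `E^σ = E_Λ`, `E'^σ = E_{Λ'}`: `∃ α ≠ 0`, `αΛ ⊆ Λ'`, `[Λ' : αΛ] = deg ψ`, and the
  coordinate identity `α · ι(2P₂Q₁²) = ι((δP₁·Q₁ − P₁·δQ₁)·Q₂)` at every affine `K̄`-point for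
  every rational representation `(P₁/Q₁, P₂/Q₂)` of `ψ` (transport along `ι`; all torsion of
  `E_Λ(ℂ)` comes from `E(K̄)`, both `n`-torsion groups having `n²` elements);
* `exists_multiplier_of_isShort` — short models over a number field: **one `α₀ ∈ Kˣ`**,
  characterised algebraically by the coordinate identity over `K̄`, works at every `σ`
  (`σ(α₀)Λ ⊆ Λ'`, `[Λ' : σ(α₀)Λ] = deg ψ`): at a point `P₀` off the exceptional set with
  `ψ(P₀) ∉ E'[2]`, `α_σ = ι_σ((N/D)(P₀))`, and `(N/D)(P₀) ∈ K̄` is `Γ_K`-fixed because the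
  conjugate polynomials represent `ψ` again (`RatRep.conj`), hence lies in `K` (Galois descent,
  `exists_algebraMap_eq_of_forall_absoluteGaloisGroup`);
* `exists_degree_eq_of_smul`, `shortChange_a₁_a₂_a₃`, `complexPeriod_map_smul_of_u_eq_one` —
  passage to short models by `(1, −b₂/12, −a₁/2, a₁b₂/24 − a₃/2)` (same `c₄, c₆, Δ`, periods and
  degree);
* `exists_norm_sq_mul_complexPeriod_eq` — **for arbitrary models `W, W'` over a number field
  and `φ : W → W'`: `∃ α ∈ Kˣ, ∀ σ, |σα|² · complexPeriod(W^σ) = deg φ · complexPeriod(W'^σ)`.**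

Everything is proved; no statement of the tree is changed. Not here: the non-archimedean
behaviour of the multiplier (integrality of `φ^*` on Néron differentials), which is the other
input of Faltings' Lemma 5.

## References

* J. H. Silverman, *The Arithmetic of Elliptic Curves*, 2nd ed., GTM 106, Springer 2009:
  Thm. VI.4.1(b) (PDF pp. 152–154), III.5 (PDF p. 75), III.1 (PDF p. 42), III.4.
  [SilvermanAEC2009]
* G. Faltings, *Finiteness theorems for abelian varieties over number fields* (transl.), in
  Cornell–Silverman, *Arithmetic Geometry*, Ch. II, §3, Lemma 5. [Faltings1986FinitenessTranslation]
-/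

noncomputable section

open scoped Classical

universe u

namespace WeierstrassCurve

namespace Isogeny

open Literature.NumberTheory.EllipticCurves PeriodPair

variable {K : Type u} [Field K] [CharZero K] {E E' : WeierstrassCurve K}

/-- **A `K`-isogeny read at a complex embedding is `z ↦ αz` with `[Λ' : αΛ] = deg`.** Let
`E, E'` be elliptic curves over a field `K` of characteristic `0`, `ψ : E → E'` an isogeny over
`K` (`WeierstrassCurve.Isogeny`), `σ : K → ℂ` an embedding with an extension `ι : K̄ → ℂ`, and
`L, L'` period pairs with `E^σ = E_Λ`, `E'^σ = E_{Λ'}` (the curves `y² = x³ − (g₂/4)x − g₃/4`).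
Then there is `α ∈ ℂˣ` with `αΛ ⊆ Λ'`, **`[Λ' : αΛ] = deg ψ`** (`= #ker ψ`), and, for every
rational representation `(P₁/Q₁, P₂/Q₂)` of `ψ` and every affine `P = (x, y) ∈ E(K̄)`,
`α · ι((2P₂Q₁²)(P)) = ι(((δP₁·Q₁ − P₁·δQ₁)·Q₂)(P))` (`δ` the invariant derivation; the
coordinate form of `ψ^*ω' = αω`, Silverman *AEC* III.5). Proof: transport `ψ` along `ι` to the
dense subgroups `ι E(K̄) ⊆ E_Λ(ℂ)`, `ι E'(K̄) ⊆ E_{Λ'}(ℂ)` (all torsion lies in the image, both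
`n`-torsion groups having `n²` elements) and apply `PeriodPair.exists_mul_of_curve_hom_card_ker`
(Silverman, *AEC*, Thm. VI.4.1(b) with the kernel count). This is the tree's
`neronLattice_commensurable_of_isogeny_of_baseChange_eq_curve` (the case `K = ℚ`), run over `K`
with the degree kept. [cite: SilvermanAEC2009, Thm. VI.4.1(b) (PDF pp. 152–154), III.5 (PDF p. 75)] -/
theorem exists_mul_of_map_eq_curve [E.IsElliptic] [E'.IsElliptic] (ψ : Isogeny E E')
    {σ : K →+* ℂ} {ι : AlgebraicClosure K →+* ℂ}
    (hι : ι.comp (algebraMap K (AlgebraicClosure K)) = σ)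
    {L L' : PeriodPair} (hE : E.map σ = L.curve) (hE' : E'.map σ = L'.curve) :
    ∃ (α : ℂ) (hα : α ≠ 0), (L.mulLeft α hα).lattice ≤ L'.lattice ∧
      (L.mulLeft α hα).lattice.toAddSubgroup.relIndex L'.lattice.toAddSubgroup = ψ.degree ∧
      ∀ (ρ : RatRep E E' ψ) (x y : AlgebraicClosure K)
        (h : (E.baseChange (AlgebraicClosure K)).toAffine.Nonsingular x y),
        α * ι (MvPolynomial.eval ![x, y] (MvPolynomial.C 2 * ρ.P₂ * ρ.Q₁ ^ 2)) =
          ι (MvPolynomial.eval ![x, y]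
            (((E.baseChange (AlgebraicClosure K)).invariantDerivation ρ.P₁ * ρ.Q₁ -
              ρ.P₁ * (E.baseChange (AlgebraicClosure K)).invariantDerivation ρ.Q₁) * ρ.Q₂)) := by
  classical
  letI : Algebra K ℂ := σ.toAlgebra
  have halgK : algebraMap K ℂ = σ := rfl
  -- the embedding `ι` as a `K`-algebra map, and the base changes along `σ`
  set ια : AlgebraicClosure K →ₐ[K] ℂ := AlgHom.mk ι (fun k ↦ by
    change ι (algebraMap K (AlgebraicClosure K) k) = σ k
    exact RingHom.congr_fun hι k) with hια
  have hια_apply : ∀ a, ια a = ι a := fun a ↦ rfl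
  have hEb : E.baseChange ℂ = L.curve := hE
  have hEb' : E'.baseChange ℂ = L'.curve := hE'
  -- Step 1: the point maps `f, f'`
  set f : E.geomPoints →+ (E.baseChange ℂ).toAffine.Point :=
    WeierstrassCurve.Affine.Point.map (W' := E) ια with hf
  set f' : E'.geomPoints →+ (E'.baseChange ℂ).toAffine.Point :=
    WeierstrassCurve.Affine.Point.map (W' := E') ια with hf'
  have hfinj : Function.Injective f := WeierstrassCurve.Affine.Point.map_injective (W' := E) ια
  have hf'inj : Function.Injective f' := WeierstrassCurve.Affine.Point.map_injective (W' := E') ια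
  have heval : ∀ (P : MvPolynomial (Fin 2) (AlgebraicClosure K)) (x y : AlgebraicClosure K),
      MvPolynomial.eval ![ι x, ι y] (MvPolynomial.map ι P) = ι (MvPolynomial.eval ![x, y] P) := by
    intro P x y
    have hv : (⇑ι) ∘ ![x, y] = ![ι x, ι y] := by
      funext i
      fin_cases i <;> rfl
    rw [MvPolynomial.map_eval ι ![x, y] P, hv]
  have hfsome : ∀ {x y : AlgebraicClosure K}
      (h : (E.baseChange (AlgebraicClosure K)).toAffine.Nonsingular x y),
      ∃ hns, f (.some x y h) = .some (ι x) (ι y) hns := fun h ↦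
    ⟨_, WeierstrassCurve.Affine.Point.map_some ια h⟩
  -- Step 2: every rational representation of `ψ` survives the transport along `ι`
  have htrans : ∀ ρ : RatRep E E' ψ,
      {m : E.geomPoints | ¬ ∃ (x y : ℂ) (h : (E.baseChange ℂ).toAffine.Nonsingular x y),
        f m = .some x y h ∧ MvPolynomial.eval ![x, y] (MvPolynomial.map ι ρ.Q₁) ≠ 0 ∧
        MvPolynomial.eval ![x, y] (MvPolynomial.map ι ρ.Q₂) ≠ 0 ∧
        ∃ h' : (E'.baseChange ℂ).toAffine.Nonsingular
            (MvPolynomial.eval ![x, y] (MvPolynomial.map ι ρ.P₁) /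
              MvPolynomial.eval ![x, y] (MvPolynomial.map ι ρ.Q₁))
            (MvPolynomial.eval ![x, y] (MvPolynomial.map ι ρ.P₂) /
              MvPolynomial.eval ![x, y] (MvPolynomial.map ι ρ.Q₂)),
          f' (ψ.toAddMonoidHom m) = .some _ _ h'}.Finite := by
    intro ρ
    refine ρ.finite_setOf_not_agrees.subset fun m hm hagree ↦ hm ?_
    obtain ⟨x, y, h, hPm, hQ₁, hQ₂, h', hφP⟩ := hagree
    have hns : (E.baseChange ℂ).toAffine.Nonsingular (ι x) (ι y) :=
      (E.toAffine.baseChange_nonsingular ια.injective x y).mpr h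
    have hns' := (E'.toAffine.baseChange_nonsingular ια.injective _ _).mpr h'
    have hfm : f m = .some (ι x) (ι y) hns := by
      rw [hPm]; exact WeierstrassCurve.Affine.Point.map_some ια h
    have hfφ : f' (ψ.toAddMonoidHom m) =
        .some (ι (MvPolynomial.eval ![x, y] ρ.P₁ / MvPolynomial.eval ![x, y] ρ.Q₁))
          (ι (MvPolynomial.eval ![x, y] ρ.P₂ / MvPolynomial.eval ![x, y] ρ.Q₂)) hns' := by
      rw [Isogeny.coe_toAddMonoidHom, hφP]; exact WeierstrassCurve.Affine.Point.map_some ια h'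
    obtain ⟨h'', he⟩ := WeierstrassCurve.Affine.Point.exists_eq_some_of_eq hfφ
      (a' := MvPolynomial.eval ![ι x, ι y] (MvPolynomial.map ι ρ.P₁) /
        MvPolynomial.eval ![ι x, ι y] (MvPolynomial.map ι ρ.Q₁))
      (b' := MvPolynomial.eval ![ι x, ι y] (MvPolynomial.map ι ρ.P₂) /
        MvPolynomial.eval ![ι x, ι y] (MvPolynomial.map ι ρ.Q₂))
      (by rw [map_div₀, heval, heval]) (by rw [map_div₀, heval, heval])
    refine ⟨ι x, ι y, hns, hfm, ?_, ?_, h'', he⟩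
    · rw [heval]; exact (map_ne_zero ι).2 hQ₁
    · rw [heval]; exact (map_ne_zero ι).2 hQ₂
  -- Step 3: all torsion of `E_Λ(ℂ)` comes from `E(K̄)` (both `n`-torsion groups have `n²` elements)
  have htors : ∀ n : ℕ, 0 < n → ∀ P : (E.baseChange ℂ).toAffine.Point, n • P = 0 →
      P ∈ f.range := by
    intro n hn P hP
    haveI : (E.baseChange (AlgebraicClosure K)).IsElliptic := by
      rw [WeierstrassCurve.baseChange]; infer_instance
    haveI : (E.baseChange ℂ).IsElliptic := by
      rw [WeierstrassCurve.baseChange]; infer_instance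
    have h1 : Nat.card (AddSubgroup.torsionBy E.geomPoints (n : ℤ)) = n ^ 2 :=
      WeierstrassCurve.card_torsionBy_eq_sq (E := E.baseChange (AlgebraicClosure K))
        (by exact_mod_cast hn.ne')
    have h2 : Nat.card (AddSubgroup.torsionBy (E.baseChange ℂ).toAffine.Point (n : ℤ)) = n ^ 2 :=
      WeierstrassCurve.card_torsionBy_eq_sq (E := E.baseChange ℂ) (by exact_mod_cast hn.ne')
    set T₁ : Set E.geomPoints :=
      (AddSubgroup.torsionBy E.geomPoints (n : ℤ) : Set E.geomPoints) with hT₁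
    set T₂ : Set (E.baseChange ℂ).toAffine.Point :=
      (AddSubgroup.torsionBy (E.baseChange ℂ).toAffine.Point (n : ℤ) :
        Set (E.baseChange ℂ).toAffine.Point) with hT₂
    have hsub : f '' T₁ ⊆ T₂ := by
      rintro _ ⟨m, hm, rfl⟩
      simp only [hT₁, hT₂, SetLike.mem_coe, AddSubgroup.torsionBy.nsmul_iff] at hm ⊢
      rw [← map_nsmul, hm, map_zero]
    have hT₂fin : T₂.Finite := by
      have : Finite (AddSubgroup.torsionBy (E.baseChange ℂ).toAffine.Point (n : ℤ)) :=
        Nat.finite_of_card_ne_zero (by rw [h2]; exact pow_ne_zero 2 hn.ne')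
      exact Set.toFinite _
    have hcard : T₂.ncard ≤ (f '' T₁).ncard := by
      rw [Set.ncard_image_of_injective _ hfinj, ← Nat.card_coe_set_eq, ← Nat.card_coe_set_eq]
      exact (h2.trans h1.symm).le
    have heq : f '' T₁ = T₂ := Set.eq_of_subset_of_ncard_le hsub hcard hT₂fin
    have hP' : P ∈ T₂ := by
      simpa only [hT₂, SetLike.mem_coe, AddSubgroup.torsionBy.nsmul_iff] using hP
    rw [← heq] at hP'
    obtain ⟨m, -, hm⟩ := hP'
    exact ⟨m, hm⟩
  -- Step 4: the analytic theorem, with the kernel count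
  set ρ₀ : RatRep E E' ψ := ψ.ratRep with hρ₀
  obtain ⟨α, hα0, hαΛ, hdeg, hformula⟩ := PeriodPair.exists_mul_of_curve_hom_card_ker L L'
    ψ.toAddMonoidHom ψ.finite_ker hEb hEb' f hfinj f' hf'inj htors (MvPolynomial.map ι ρ₀.P₁)
    (MvPolynomial.map ι ρ₀.Q₁) (MvPolynomial.map ι ρ₀.P₂) (MvPolynomial.map ι ρ₀.Q₂) (htrans ρ₀)
  -- Step 5: the identity `α · D(P) = N(P)` at `K̄`-points, for every representation
  have hEmap : (E.baseChange (AlgebraicClosure K)).map ι = E.baseChange ℂ := by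
    simp only [WeierstrassCurve.baseChange, WeierstrassCurve.map_map, hι, halgK]
  refine ⟨α, hα0, mulLeft_lattice_le_of_forall_mul_mem hα0 hαΛ, hdeg, fun ρ x y h ↦ ?_⟩
  obtain ⟨hns, hfm⟩ := hfsome h
  have H := hformula (MvPolynomial.map ι ρ.P₁) (MvPolynomial.map ι ρ.Q₁)
    (MvPolynomial.map ι ρ.P₂) (MvPolynomial.map ι ρ.Q₂) (htrans ρ) _ _ _ hns hfm
  have e1 : MvPolynomial.C 2 * MvPolynomial.map ι ρ.P₂ * MvPolynomial.map ι ρ.Q₁ ^ 2 =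
      MvPolynomial.map ι (MvPolynomial.C 2 * ρ.P₂ * ρ.Q₁ ^ 2) := by
    simp only [map_mul, map_pow, map_ofNat]
  have e2 : ((E.baseChange ℂ).invariantDerivation (MvPolynomial.map ι ρ.P₁) *
        MvPolynomial.map ι ρ.Q₁ -
      MvPolynomial.map ι ρ.P₁ * (E.baseChange ℂ).invariantDerivation (MvPolynomial.map ι ρ.Q₁)) *
        MvPolynomial.map ι ρ.Q₂ =
      MvPolynomial.map ι
        (((E.baseChange (AlgebraicClosure K)).invariantDerivation ρ.P₁ * ρ.Q₁ -
          ρ.P₁ * (E.baseChange (AlgebraicClosure K)).invariantDerivation ρ.Q₁) * ρ.Q₂) := by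
    rw [← hEmap, WeierstrassCurve.invariantDerivation_map,
      WeierstrassCurve.invariantDerivation_map]
    simp only [map_mul, map_sub]
  rw [e1, e2, heval, heval] at H
  exact H


/-! ### Embeddings -/

omit [CharZero K] in
/-- Every embedding `σ : K → ℂ` extends to `K̄ → ℂ` (`ℂ` is algebraically closed; Mathlib
`IsAlgClosed.lift`). [folklore] -/
theorem exists_ringHom_algebraicClosure_comp_eq (σ : K →+* ℂ) :
    ∃ ι : AlgebraicClosure K →+* ℂ, ι.comp (algebraMap K (AlgebraicClosure K)) = σ := by
  letI : Algebra K ℂ := σ.toAlgebra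
  exact ⟨(IsAlgClosed.lift (R := K) (S := AlgebraicClosure K) (M := ℂ) : AlgebraicClosure K →ₐ[K] ℂ),
    AlgHom.comp_algebraMap _⟩

/-- A Weierstrass model over `ℂ` with `a₁ = a₂ = a₃ = 0` *is* the curve `E_Λ` of its Néron-type
period pair (`g₂(Λ) = c₄/12`, `g₃(Λ) = c₆/216`): `c₄ = −48a₄`, `c₆ = −864a₆`. [folklore] -/
theorem _root_.WeierstrassCurve.eq_curve_of_a₁_a₂_a₃ (V : WeierstrassCurve ℂ) (h₁ : V.a₁ = 0)
    (h₂ : V.a₂ = 0) (h₃ : V.a₃ = 0) {L : PeriodPair} (hg₂ : L.g₂ = V.c₄ / 12)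
    (hg₃ : L.g₃ = V.c₆ / 216) : V = L.curve := by
  have h4 : V.a₄ = -L.g₂ / 4 := by
    rw [hg₂]
    simp only [WeierstrassCurve.c₄, WeierstrassCurve.b₂, WeierstrassCurve.b₄, h₁, h₂, h₃]
    ring
  have h6 : V.a₆ = -L.g₃ / 4 := by
    rw [hg₃]
    simp only [WeierstrassCurve.c₆, WeierstrassCurve.b₂, WeierstrassCurve.b₄, WeierstrassCurve.b₆,
      h₁, h₂, h₃]
    ring
  ext <;> simp [h₁, h₂, h₃, h4, h6]

/-! ### Galois descent of the multiplier -/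

/-- **The multiplier of a `K`-isogeny lies in `K` and has index `deg` at every complex place.**
Let `E, E'` be elliptic curves over a number field `K` given by *short* Weierstrass models
(`a₁ = a₂ = a₃ = 0`) and `ψ : E → E'` an isogeny over `K`. There is `α₀ ∈ Kˣ` such that

* (algebraic characterisation, `ψ^*ω' = α₀ω` in coordinates, Silverman *AEC* III.5) for every
  rational representation `(P₁/Q₁, P₂/Q₂)` of `ψ` and every affine `(x, y) ∈ E(K̄)`,
  `α₀ · (2P₂Q₁²)(x, y) = ((δP₁·Q₁ − P₁·δQ₁)·Q₂)(x, y)`, `δ` the invariant derivation;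
* (analytic, Silverman *AEC* VI.4.1(b)) for every embedding `σ : K → ℂ` and Néron-type period
  pairs `L, L'` of `E^σ, E'^σ` (`g₂ = c₄/12`, `g₃ = c₆/216`): `σ(α₀)Λ ⊆ Λ'` with
  **`[Λ' : σ(α₀)Λ] = deg ψ`**.

Proof (the tree's `neronLattice_commensurable_of_isogeny_of_baseChange_eq_curve`, `K = ℚ`,
run over `K`): at each `σ`, `exists_mul_of_map_eq_curve` gives `α_σ` and the coordinate identity
read through an extension `ι_σ : K̄ → ℂ`; at a point `P₀` off the exceptional set with
`ψ(P₀) ∉ E'[2]` the factor `2P₂Q₁²` is non-zero, so `α_σ = ι_σ(α₀)` with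
`α₀ = (N/D)(P₀) ∈ K̄` *independent of `σ`*; the conjugate representations (`RatRep.conj`,
`Γ_K`-equivariance) give `α_σ = ι_σ(τα₀)` for `τ ∈ Γ_K`, so `α₀ ∈ K̄^{Γ_K} = K`.
[cite: SilvermanAEC2009, Thm. VI.4.1(b) (PDF pp. 152–154), III.5 (PDF p. 75)] -/
theorem exists_multiplier_of_isShort [NumberField K] [E.IsElliptic] [E'.IsElliptic]
    (ψ : Isogeny E E') (h₁ : E.a₁ = 0) (h₂ : E.a₂ = 0) (h₃ : E.a₃ = 0) (h₁' : E'.a₁ = 0)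
    (h₂' : E'.a₂ = 0) (h₃' : E'.a₃ = 0) :
    ∃ α₀ : K, α₀ ≠ 0 ∧
      (∀ (ρ : RatRep E E' ψ) (x y : AlgebraicClosure K)
        (h : (E.baseChange (AlgebraicClosure K)).toAffine.Nonsingular x y),
        algebraMap K (AlgebraicClosure K) α₀ *
            MvPolynomial.eval ![x, y] (MvPolynomial.C 2 * ρ.P₂ * ρ.Q₁ ^ 2) =
          MvPolynomial.eval ![x, y]
            (((E.baseChange (AlgebraicClosure K)).invariantDerivation ρ.P₁ * ρ.Q₁ -
              ρ.P₁ * (E.baseChange (AlgebraicClosure K)).invariantDerivation ρ.Q₁) * ρ.Q₂)) ∧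
      ∀ (σ : K →+* ℂ) (L L' : PeriodPair), L.g₂ = (E.map σ).c₄ / 12 → L.g₃ = (E.map σ).c₆ / 216 →
        L'.g₂ = (E'.map σ).c₄ / 12 → L'.g₃ = (E'.map σ).c₆ / 216 →
        ∃ hσ : σ α₀ ≠ 0, (L.mulLeft (σ α₀) hσ).lattice ≤ L'.lattice ∧
          (L.mulLeft (σ α₀) hσ).lattice.toAddSubgroup.relIndex L'.lattice.toAddSubgroup =
            ψ.degree := by
  classical
  -- the curves at an embedding are `E_Λ`, `E_{Λ'}`
  have hcurve : ∀ (σ : K →+* ℂ) (L : PeriodPair), L.g₂ = (E.map σ).c₄ / 12 →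
      L.g₃ = (E.map σ).c₆ / 216 → E.map σ = L.curve := fun σ L hg₂ hg₃ ↦
    (E.map σ).eq_curve_of_a₁_a₂_a₃ (by simp [h₁]) (by simp [h₂]) (by simp [h₃]) hg₂ hg₃
  have hcurve' : ∀ (σ : K →+* ℂ) (L' : PeriodPair), L'.g₂ = (E'.map σ).c₄ / 12 →
      L'.g₃ = (E'.map σ).c₆ / 216 → E'.map σ = L'.curve := fun σ L' hg₂ hg₃ ↦
    (E'.map σ).eq_curve_of_a₁_a₂_a₃ (by simp [h₁']) (by simp [h₂']) (by simp [h₃']) hg₂ hg₃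
  -- Step 6: a good point `P₀ = (x₀, y₀)`: off the exceptional set of `ρ₀`, `ψ P₀ ∉ E'[2]`
  set ρ₀ : RatRep E E' ψ := ψ.ratRep with hρ₀
  have hE2fin : {m : E.geomPoints | (2 : ℕ) • ψ m = 0}.Finite := by
    haveI : (E'.baseChange (AlgebraicClosure K)).IsElliptic := by
      rw [WeierstrassCurve.baseChange]; infer_instance
    have hcard : Nat.card (AddSubgroup.torsionBy E'.geomPoints ((2 : ℕ) : ℤ)) = 2 ^ 2 :=
      WeierstrassCurve.card_torsionBy_eq_sq (E := E'.baseChange (AlgebraicClosure K)) (n := 2)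
        (by norm_num)
    have hfin2 : (AddSubgroup.torsionBy E'.geomPoints ((2 : ℕ) : ℤ) : Set E'.geomPoints).Finite := by
      have : Finite (AddSubgroup.torsionBy E'.geomPoints ((2 : ℕ) : ℤ)) :=
        Nat.finite_of_card_ne_zero (by rw [hcard]; norm_num)
      exact Set.toFinite _
    have hpre := PeriodPair.finite_preimage_of_finite_ker ψ.toAddMonoidHom ψ.finite_ker hfin2
    refine hpre.subset fun m hm ↦ ?_
    simp only [Set.mem_setOf_eq] at hm
    simp only [Set.mem_preimage, SetLike.mem_coe, AddSubgroup.torsionBy.nsmul_iff,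
      Isogeny.coe_toAddMonoidHom]
    exact hm
  obtain ⟨P₀, hP₀⟩ :=
    Infinite.exists_notMem_finset ((ρ₀.exc : Finset E.geomPoints) ∪ hE2fin.toFinset)
  rw [Finset.mem_union, not_or] at hP₀
  obtain ⟨hP₀exc, hP₀2⟩ := hP₀
  have hP₀2' : ¬ (2 : ℕ) • ψ P₀ = 0 := fun h ↦ hP₀2 (hE2fin.mem_toFinset.2 h)
  obtain ⟨x₀, y₀, h₀, rfl⟩ : ∃ x₀ y₀ h₀, P₀ = .some x₀ y₀ h₀ := by
    change (E.baseChange (AlgebraicClosure K)).toAffine.Point at P₀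
    rcases P₀ with _ | ⟨x₀, y₀, h₀⟩
    · exact (hP₀exc ρ₀.zero_mem_exc).elim
    · exact ⟨x₀, y₀, h₀, rfl⟩
  obtain ⟨hQ₁0, hQ₂0, h₀', hψP₀⟩ := ρ₀.apply_eq_of_not_mem_exc h₀ hP₀exc
  have hP₂0 : MvPolynomial.eval ![x₀, y₀] ρ₀.P₂ ≠ 0 := by
    intro h0
    apply hP₀2'
    have hy : MvPolynomial.eval ![x₀, y₀] ρ₀.P₂ / MvPolynomial.eval ![x₀, y₀] ρ₀.Q₂ = 0 := by
      rw [h0, zero_div]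
    rw [hψP₀]
    exact two_nsmul_eq_zero_of_y_eq_zero (W := E') h₁' h₃' h₀' hy
  -- the polynomials `D_ρ = 2P₂Q₁²`, `N_ρ = (δP₁·Q₁ − P₁·δQ₁)·Q₂`
  set D : RatRep E E' ψ → MvPolynomial (Fin 2) (AlgebraicClosure K) :=
    fun ρ ↦ MvPolynomial.C 2 * ρ.P₂ * ρ.Q₁ ^ 2 with hD
  set N : RatRep E E' ψ → MvPolynomial (Fin 2) (AlgebraicClosure K) := fun ρ ↦
    ((E.baseChange (AlgebraicClosure K)).invariantDerivation ρ.P₁ * ρ.Q₁ -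
      ρ.P₁ * (E.baseChange (AlgebraicClosure K)).invariantDerivation ρ.Q₁) * ρ.Q₂ with hN
  have hD₀ne : MvPolynomial.eval ![x₀, y₀] (D ρ₀) ≠ 0 := by
    simp only [hD, map_mul, map_pow, MvPolynomial.eval_C]
    exact mul_ne_zero (mul_ne_zero two_ne_zero hP₂0) (pow_ne_zero 2 hQ₁0)
  -- Step 7: `α₀ = N₀ / D₀ ∈ K̄`; at every embedding the multiplier is `ι α₀`
  set α₀ : AlgebraicClosure K :=
    MvPolynomial.eval ![x₀, y₀] (N ρ₀) / MvPolynomial.eval ![x₀, y₀] (D ρ₀) with hα₀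
  have hemb : ∀ (σ : K →+* ℂ) (ι : AlgebraicClosure K →+* ℂ),
      ι.comp (algebraMap K (AlgebraicClosure K)) = σ → ∀ (L L' : PeriodPair),
      E.map σ = L.curve → E'.map σ = L'.curve →
      ∃ (hα : ι α₀ ≠ 0), (L.mulLeft (ι α₀) hα).lattice ≤ L'.lattice ∧
        (L.mulLeft (ι α₀) hα).lattice.toAddSubgroup.relIndex L'.lattice.toAddSubgroup = ψ.degree ∧
        ∀ (ρ : RatRep E E' ψ) (x y : AlgebraicClosure K)
          (h : (E.baseChange (AlgebraicClosure K)).toAffine.Nonsingular x y),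
          ι α₀ * ι (MvPolynomial.eval ![x, y] (D ρ)) = ι (MvPolynomial.eval ![x, y] (N ρ)) := by
    intro σ ι hι L L' hL hL'
    obtain ⟨α, hα, hle, hdeg, hkey⟩ := ψ.exists_mul_of_map_eq_curve hι hL hL'
    have hαι : α = ι α₀ := by
      have H := hkey ρ₀ x₀ y₀ h₀
      rw [hα₀, map_div₀, eq_div_iff ((map_ne_zero ι).2 hD₀ne)]
      exact H
    subst hαι
    exact ⟨hα, hle, hdeg, hkey⟩
  -- one embedding `σ₁`, `ι₁`
  have hσ₁ : Nonempty (K →+* ℂ) := by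
    rw [← Fintype.card_pos_iff, NumberField.Embeddings.card K ℂ]
    exact Module.finrank_pos
  obtain ⟨σ₁⟩ := hσ₁
  obtain ⟨ι₁, hι₁⟩ := exists_ringHom_algebraicClosure_comp_eq σ₁
  obtain ⟨L₁, hL₁g₂, hL₁g₃⟩ := (E.map σ₁).exists_periodPair_of_isElliptic'
  obtain ⟨L₁', hL₁'g₂, hL₁'g₃⟩ := (E'.map σ₁).exists_periodPair_of_isElliptic'
  obtain ⟨hα₁, -, -, hkey₁⟩ := hemb σ₁ ι₁ hι₁ L₁ L₁' (hcurve σ₁ L₁ hL₁g₂ hL₁g₃)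
    (hcurve' σ₁ L₁' hL₁'g₂ hL₁'g₃)
  -- Step 8: `α₀` is fixed by `Γ_K`
  have hfix : ∀ τ : Field.absoluteGaloisGroup K,
      Field.absoluteGaloisGroup.toAlgEquiv K τ α₀ = α₀ := by
    intro τ
    set τ' : AlgebraicClosure K ≃ₐ[K] AlgebraicClosure K :=
      Field.absoluteGaloisGroup.toAlgEquiv K τ with hτ'
    set ρτ : RatRep E E' ψ := ρ₀.conj τ (fun P ↦ ψ.map_smul τ P) with hρτ
    obtain ⟨hτns, eτ⟩ := geomPoints.smul_some (W := E) τ h₀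
    have H := hkey₁ ρτ _ _ hτns
    have hEQτ : (E.baseChange (AlgebraicClosure K)).map (RatRep.galHom τ) =
        E.baseChange (AlgebraicClosure K) := by
      simp only [WeierstrassCurve.baseChange, WeierstrassCurve.map_map]
      congr 1
      ext a
      simp
    have e1 : D ρτ = MvPolynomial.map (RatRep.galHom τ) (D ρ₀) := by
      simp only [hD, hρτ, RatRep.conj_P₂, RatRep.conj_Q₁, map_mul, map_pow, map_ofNat]
    have e2 : N ρτ = MvPolynomial.map (RatRep.galHom τ) (N ρ₀) := by
      simp only [hN, hρτ, RatRep.conj_P₁, RatRep.conj_Q₁, RatRep.conj_Q₂]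
      conv_lhs => rw [← hEQτ]
      rw [WeierstrassCurve.invariantDerivation_map, WeierstrassCurve.invariantDerivation_map]
      simp only [map_mul, map_sub]
    rw [e1, e2, ← RatRep.galois_eval_vec₂, ← RatRep.galois_eval_vec₂] at H
    -- `H : ι₁ α₀ * ι₁ (τ D₀) = ι₁ (τ N₀)`, so `α₀ = τ N₀ / τ D₀ = τ α₀`
    have hτD : τ' (MvPolynomial.eval ![x₀, y₀] (D ρ₀)) ≠ 0 := (map_ne_zero τ').2 hD₀ne
    have hιτD : ι₁ (τ' (MvPolynomial.eval ![x₀, y₀] (D ρ₀))) ≠ 0 := (map_ne_zero ι₁).2 hτD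
    have h' : ι₁ α₀ = ι₁ (τ' α₀) := by
      conv_rhs => rw [hα₀, map_div₀ τ', map_div₀ ι₁]
      rw [eq_div_iff hιτD]
      exact H
    exact (ι₁.injective h').symm
  -- Step 9: Galois descent: `α₀ ∈ K`
  obtain ⟨q, hq⟩ := exists_algebraMap_eq_of_forall_absoluteGaloisGroup hfix
  have hq0 : q ≠ 0 := by
    rintro rfl
    exact hα₁ (by rw [← hq, map_zero, map_zero])
  refine ⟨q, hq0, fun ρ x y h ↦ ?_, fun σ L L' hg₂ hg₃ hg₂' hg₃' ↦ ?_⟩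
  · -- the coordinate identity in `K̄`
    apply ι₁.injective
    rw [map_mul, hq]
    exact hkey₁ ρ x y h
  · obtain ⟨ι, hι⟩ := exists_ringHom_algebraicClosure_comp_eq σ
    obtain ⟨hα, hle, hdeg, -⟩ := hemb σ ι hι L L' (hcurve σ L hg₂ hg₃) (hcurve' σ L' hg₂' hg₃')
    have hσq : σ q = ι α₀ := by
      rw [← hq, ← RingHom.comp_apply, hι]
    refine ⟨by rw [hσq]; exact hα, ?_, ?_⟩
    · simpa only [hσq] using hle
    · simpa only [hσq] using hdeg


/-! ### Arbitrary models: passage to short models -/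

omit [CharZero K] in
/-- An isogeny `C • W → W` for a change of variables `C` over `K` which is a bijection on
`K̄`-points (the substitution isomorphism of `C⁻¹`, the tree's `VariableChange.toIsogeny`,
transported along `C⁻¹ • (C • W) = W`). Silverman, *AEC*, III.3.1(b), III.4 (Def.). [folklore] -/
theorem exists_bijective_of_smul (W : WeierstrassCurve K) (C : VariableChange K) :
    ∃ e : Isogeny (C • W) W, Function.Bijective e := by
  have h : ∃ e : Isogeny (C • W) (C⁻¹ • (C • W)), Function.Bijective e :=
    ⟨VariableChange.toIsogeny (C • W) C⁻¹, VariableChange.toIsogeny_injective _ _,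
      VariableChange.toIsogeny_surjective _ _⟩
  rwa [inv_smul_smul] at h

omit [CharZero K] in
/-- **Isogenies transport to isomorphic models with the same degree**: for changes of variables
`C, C'` over `K` and an isogeny `φ : W → W'` there is an isogeny `C • W → C' • W'` of the same
degree (`= #ker`), namely `ι_{C'} ∘ φ ∘ ι_C⁻¹` with the substitution isomorphisms (Silverman,
*AEC*, III.3.1(b), III.4). [folklore] -/
theorem exists_degree_eq_of_smul {W W' : WeierstrassCurve K} (φ : Isogeny W W')
    (C C' : VariableChange K) :
    ∃ ψ : Isogeny (C • W) (C' • W'), ψ.degree = φ.degree := by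
  classical
  obtain ⟨e, he⟩ := exists_bijective_of_smul W C
  refine ⟨(VariableChange.toIsogeny W' C').comp (φ.comp e), ?_⟩
  unfold Isogeny.degree
  refine Nat.card_congr (Equiv.subtypeEquiv (Equiv.ofBijective e he) fun P ↦ ?_)
  simp only [AddMonoidHom.mem_ker, Equiv.ofBijective_apply, Isogeny.coe_toAddMonoidHom,
    Isogeny.comp_apply]
  constructor
  · intro h
    apply VariableChange.toIsogeny_injective W' C'
    rw [h, map_zero]
  · intro h
    rw [h, map_zero]

omit [CharZero K] in
/-- The change of variables `C_W = (1, −b₂/12, −a₁/2, a₁b₂/24 − a₃/2)` (completing the square and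
the cube; Silverman, *AEC*, III.1, Mathlib's `toShortNF` made explicit) produces a model with
`a₁ = a₂ = a₃ = 0`; as `u = 1`, it does not change `c₄, c₆, Δ` nor the differential.
[cite: SilvermanAEC2009, III.1 (PDF p. 42)] -/
theorem shortChange_a₁_a₂_a₃ [Invertible (2 : K)] [Invertible (3 : K)] (W : WeierstrassCurve K) :
    ((⟨1, -W.b₂ / 12, -W.a₁ / 2, W.a₁ * W.b₂ / 24 - W.a₃ / 2⟩ : VariableChange K) • W).a₁ = 0 ∧
    ((⟨1, -W.b₂ / 12, -W.a₁ / 2, W.a₁ * W.b₂ / 24 - W.a₃ / 2⟩ : VariableChange K) • W).a₂ = 0 ∧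
    ((⟨1, -W.b₂ / 12, -W.a₁ / 2, W.a₁ * W.b₂ / 24 - W.a₃ / 2⟩ : VariableChange K) • W).a₃ = 0 := by
  have h2 : (2 : K) ≠ 0 := (isUnit_of_invertible (2 : K)).ne_zero
  have h3 : (3 : K) ≠ 0 := (isUnit_of_invertible (3 : K)).ne_zero
  have h12 : (12 : K) ≠ 0 := by
    rw [show (12 : K) = 2 * 2 * 3 by norm_num]; exact mul_ne_zero (mul_ne_zero h2 h2) h3
  have h24 : (24 : K) ≠ 0 := by
    rw [show (24 : K) = 2 * 12 by norm_num]; exact mul_ne_zero h2 h12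
  refine ⟨?_, ?_, ?_⟩
  · simp only [variableChange_a₁, inv_one, Units.val_one, one_mul]
    field_simp
    ring
  · simp only [variableChange_a₂, inv_one, Units.val_one, one_pow, one_mul, WeierstrassCurve.b₂]
    field_simp
    ring
  · simp only [variableChange_a₃, inv_one, Units.val_one, one_pow, one_mul, WeierstrassCurve.b₂]
    field_simp
    ring

omit [CharZero K] in
/-- The complex period is unchanged by a change of variables with `u = 1` (it scales by
`|σ(u)|²`, the tree's `complexPeriod_smul_holds`). [folklore] -/
theorem complexPeriod_map_smul_of_u_eq_one (W : WeierstrassCurve K) (C : VariableChange K)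
    (hu : C.u = 1) (σ : K →+* ℂ) : ((C • W).map σ).complexPeriod = (W.map σ).complexPeriod := by
  rw [← map_variableChange, (W.map σ).complexPeriod_smul_holds, VariableChange.map_u, hu]
  simp

/-- **`‖φ^*α‖² = deg φ · ‖α‖²` for an isogeny of elliptic curves over a number field.** For
elliptic curves `W, W'` over a number field `K` (any Weierstrass models) and an isogeny
`φ : W → W'` over `K` there is `α ∈ Kˣ` (the multiplier `φ^*ω_{W'} = α ω_W`, Silverman *AEC*
III.5) with, for every embedding `σ : K → ℂ`,
`|σ(α)|² · complexPeriod(W^σ) = deg φ · complexPeriod(W'^σ)`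
(`complexPeriod = 2 covol` of the period lattice of `ω`): at each `σ` the isogeny is
`z ↦ σ(α)z : ℂ/Λ_{W,σ} → ℂ/Λ_{W',σ}` with `[Λ_{W',σ} : σ(α)Λ_{W,σ}] = deg φ` (Silverman, *AEC*,
Thm. VI.4.1(b); `exists_multiplier_of_isShort` after passing to short models by changes of
variables with `u = 1`, which change neither the periods nor the degree), and
`covol(σ(α)Λ) = |σ(α)|² covol(Λ) = [Λ' : σ(α)Λ] covol(Λ')`. This is the archimedean input
`‖φ^*α‖_σ² = deg φ · ‖α‖_σ²` of Faltings' isogeny lemma (Faltings 1983, §3, proof of Lemma 5)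
for elliptic curves. [cite: SilvermanAEC2009, Thm. VI.4.1(b) (PDF pp. 152–154), III.5 (PDF p. 75)] -/
theorem exists_norm_sq_mul_complexPeriod_eq [NumberField K] {W W' : WeierstrassCurve K}
    [W.IsElliptic] [W'.IsElliptic] (φ : Isogeny W W') :
    ∃ α : K, α ≠ 0 ∧ ∀ σ : K →+* ℂ,
      ‖σ α‖ ^ 2 * (W.map σ).complexPeriod = φ.degree * (W'.map σ).complexPeriod := by
  classical
  haveI : Invertible (2 : K) := invertibleOfNonzero two_ne_zero
  haveI : Invertible (3 : K) := invertibleOfNonzero three_ne_zero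
  set C : VariableChange K := ⟨1, -W.b₂ / 12, -W.a₁ / 2, W.a₁ * W.b₂ / 24 - W.a₃ / 2⟩ with hC
  set C' : VariableChange K := ⟨1, -W'.b₂ / 12, -W'.a₁ / 2, W'.a₁ * W'.b₂ / 24 - W'.a₃ / 2⟩
    with hC'
  obtain ⟨h₁, h₂, h₃⟩ := shortChange_a₁_a₂_a₃ W
  obtain ⟨h₁', h₂', h₃'⟩ := shortChange_a₁_a₂_a₃ W'
  obtain ⟨ψ, hψ⟩ := exists_degree_eq_of_smul φ C C'
  obtain ⟨α₀, hα₀, -, han⟩ := exists_multiplier_of_isShort ψ h₁ h₂ h₃ h₁' h₂' h₃'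
  refine ⟨α₀, hα₀, fun σ ↦ ?_⟩
  obtain ⟨L, hL₂, hL₃⟩ := ((C • W).map σ).exists_periodPair_of_isElliptic'
  obtain ⟨L', hL₂', hL₃'⟩ := ((C' • W').map σ).exists_periodPair_of_isElliptic'
  obtain ⟨hσ, hle, hdeg⟩ := han σ L L' hL₂ hL₃ hL₂' hL₃'
  rw [← complexPeriod_map_smul_of_u_eq_one W C rfl σ,
    ← complexPeriod_map_smul_of_u_eq_one W' C' rfl σ,
    ((C • W).map σ).complexPeriod_eq_two_mul_covolume' hL₂ hL₃,
    ((C' • W').map σ).complexPeriod_eq_two_mul_covolume' hL₂' hL₃', ← hψ, ← hdeg]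
  have hcov := ZLattice.covolume_div_covolume_eq_relIndex' (L.mulLeft (σ α₀) hσ).lattice
    L'.lattice hle
  rw [L.covolume_mulLeft_lattice (σ α₀) hσ,
    div_eq_iff (ZLattice.covolume_pos L'.lattice _).ne'] at hcov
  calc ‖σ α₀‖ ^ 2 * (2 * ZLattice.covolume L.lattice)
      = 2 * (‖σ α₀‖ ^ 2 * ZLattice.covolume L.lattice) := by ring
    _ = ((L.mulLeft (σ α₀) hσ).lattice.toAddSubgroup.relIndex L'.lattice.toAddSubgroup : ℕ) *
        (2 * ZLattice.covolume L'.lattice) := by rw [hcov]; ring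

end Isogeny

end WeierstrassCurve

end
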